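import Mathlib
import Literature.RingTheory.MvPolynomial.LinearFormsCoeff
import Summits.ValiantsHypothesis.ValiantsHypothesis.Theorems.RigidityForcesSymmetryRankRigidMinimalReprLaplaceFiveStarLemmaKDirectional
import Summits.ValiantsHypothesis.ValiantsHypothesis.Theorems.RigidityForcesSymmetryRankRigidMinimalReprLaplaceFiveStarLemmaKLinearDivisor
import Summits.ValiantsHypothesis.ValiantsHypothesis.Theorems.RigidityForcesSymmetryRankRigidMinimalReprLaplaceFiveStarLemmaKBinaryCubic

/-!
# ValiantsHypothesis / RigidityForcesSymmetry — crux `LaplaceOptimalFive` (stmt-ValiantsHypothesis-24813), crux idea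
`young-shadow` (K1) on the star: **LEMMA K, CASE (b) — A SQUARE MEMBER `L²`: THE CUBIC LIES IN `L·⟨L², Q''⟩`, OR THE PENCIL IS BINARY**
(referee note `NOTE-crit3g5-24813-Lemma2prime-elementary.md` §B (b); memo `NOTE-p4g15-24813-K1-star.md` §14 (b))

Pencil `⟨L², Q''⟩` (`L = Σ λ_z X_z`, `λ_{z₀} ≠ 0`, `Q'' = Σ C(U'' a b) X_a X_b` symmetric), cubic form `K` with the REDUCED minors
`det[∂K | λ | ∂Q''] = 0` (the minors of `[∂K | ∂(L²) | ∂Q'']` divided by `2L`).  Coordinate-free version of the referee's §B (b):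

* `wedge_on_hyperplane` — for `v, w ∈ ker λ`: `D_w K · D_v Q'' = D_v K · D_w Q''` (✓ `det3_sum_mid/last`);
* `dirDeriv_quadric_test` — `D_{h_x} Q'' = Σ_d 2ν_x(d) X_d` on the test vectors `h_x = λ_{z₀} e_x − λ_x e_{z₀}`,
  `ν_x(d) = λ_{z₀} U''(x,d) − λ_x U''(z₀,d)`;
* ★ `cubic_of_square_member_nondeg` — if two of the linear forms `D_{h_x} Q''` are NOT proportional then
  `K = C β · L · Q'' + C c · L³` (primality of `D_{h₁}Q''`, the Hessian symmetry `C(b·w) D_vQ'' = C(b·v) D_wQ''`, and the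
  invariance lemma ✓ `eq_C_mul_pow_of_dirDeriv_eq_zero`);
* ★ `binary_of_square_member_deg` — if all `D_{h_x} Q''` are pairwise proportional then every column of `U''` lies in `⟨λ, f⟩` for one
  vector `f` (the pencil is BINARY; ✓ `eq_symm_rankTwo_of_vanishing`).

Pure algebra; no star hypotheses, no definitions, no `sorry`.  Honest framing: helper toward the Lean price (L2) of the K1-on-the-star
theorem (PAPER, referee PASS; not kernel); `LaplaceOptimalFive` OPEN · CONTESTED 72/120; `VP ≠ VNP` NOT proved.
-/

set_option linter.dupNamespace false

namespace Summit.ValiantsHypothesis.ValiantsHypothesis.Theorems.RigidityForcesSymmetryRankRigidMinimalRepr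

namespace LaplaceFiveStar

open Finset MvPolynomial

/-- **Wedge on the hyperplane.**  If `det[k | C∘λ | q](a,b,c) = 0` for all rows and `λ_{z₀} ≠ 0`, then for `v, w ∈ ker λ`:
`K_w · Q_v = K_v · Q_w` with `K_v = Σ C(v_b) k_b`, `Q_v = Σ C(v_b) q_b`. [folklore] -/
theorem wedge_on_hyperplane (k q : Fin 5 → MvPolynomial (Fin 5) ℂ) (lam : Fin 5 → ℂ) (z₀ : Fin 5) (hlam : lam z₀ ≠ 0)
    (hT' : ∀ a b c : Fin 5, k a * (C (lam b) * q c - C (lam c) * q b) - k b * (C (lam a) * q c - C (lam c) * q a)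
      + k c * (C (lam a) * q b - C (lam b) * q a) = 0)
    (v w : Fin 5 → ℂ) (hv : ∑ a : Fin 5, v a * lam a = 0) (hw : ∑ a : Fin 5, w a * lam a = 0) :
    (∑ c : Fin 5, C (w c) * k c) * (∑ b : Fin 5, C (v b) * q b)
      = (∑ b : Fin 5, C (v b) * k b) * (∑ c : Fin 5, C (w c) * q c) := by
  have hΛ : ∀ u : Fin 5 → ℂ, ∑ a : Fin 5, u a * lam a = 0 →
      ∑ b : Fin 5, C (u b) * (C (lam b) : MvPolynomial (Fin 5) ℂ) = 0 := by
    intro u hu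
    rw [← (Finset.sum_congr rfl fun b _ => (map_mul C (u b) (lam b))), ← map_sum, hu, C_0]
  have h1 : ∀ c : Fin 5,
      k z₀ * ((∑ b : Fin 5, C (v b) * C (lam b)) * q c - C (lam c) * (∑ b : Fin 5, C (v b) * q b))
        - (∑ b : Fin 5, C (v b) * k b) * (C (lam z₀) * q c - C (lam c) * q z₀)
        + k c * (C (lam z₀) * (∑ b : Fin 5, C (v b) * q b) - (∑ b : Fin 5, C (v b) * C (lam b)) * q z₀) = 0 :=
    fun c => det3_sum_mid (k z₀) (C (lam z₀)) (q z₀) (k c) (C (lam c)) (q c) k (fun b => C (lam b)) q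
      (fun b => C (v b)) (fun b => hT' z₀ b c)
  have h2 := det3_sum_last (k z₀) (C (lam z₀)) (q z₀) (∑ b : Fin 5, C (v b) * k b)
    (∑ b : Fin 5, C (v b) * C (lam b)) (∑ b : Fin 5, C (v b) * q b) k (fun c => C (lam c)) q (fun c => C (w c)) h1
  rw [hΛ v hv, hΛ w hw] at h2
  have h3 : (C (lam z₀) : MvPolynomial (Fin 5) ℂ) *
      ((∑ c : Fin 5, C (w c) * k c) * (∑ b : Fin 5, C (v b) * q b)
        - (∑ b : Fin 5, C (v b) * k b) * (∑ c : Fin 5, C (w c) * q c)) = 0 := by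
    linear_combination h2
  have hC0 : (C (lam z₀) : MvPolynomial (Fin 5) ℂ) ≠ 0 := by
    rw [Ne, C_eq_zero]; exact hlam
  exact sub_eq_zero.mp ((mul_eq_zero.mp h3).resolve_left hC0)

/-- `D_{h_x} Q''` on the test vector `h_x = λ_{z₀} e_x − λ_x e_{z₀}`:  `Σ_d 2(λ_{z₀} U''(x,d) − λ_x U''(z₀,d)) • X_d`. [folklore] -/
theorem dirDeriv_quadric_test (U : Fin 5 → Fin 5 → ℂ) (hU : ∀ a b : Fin 5, U a b = U b a) (lam : Fin 5 → ℂ) (z₀ x : Fin 5) :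
    ∑ a : Fin 5, C (lam z₀ * (if a = x then (1 : ℂ) else 0) - lam x * (if a = z₀ then (1 : ℂ) else 0)) *
        pderiv a (∑ i : Fin 5, ∑ j : Fin 5, C (U i j) * X i * X j : MvPolynomial (Fin 5) ℂ)
      = ∑ d : Fin 5, (2 * (lam z₀ * U x d - lam x * U z₀ d)) • (X d : MvPolynomial (Fin 5) ℂ) := by
  rw [dirDeriv_quadric]
  refine Finset.sum_congr rfl fun d _ => ?_
  rw [smul_eq_C_mul]
  congr 2
  have e : ∀ a : Fin 5, (lam z₀ * (if a = x then (1 : ℂ) else 0) - lam x * (if a = z₀ then (1 : ℂ) else 0)) * (U a d + U d a)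
      = (if a = x then lam z₀ * (2 * U a d) else 0) - (if a = z₀ then lam x * (2 * U a d) else 0) := by
    intro a
    rw [hU d a]
    split_ifs <;> ring
  rw [Finset.sum_congr rfl fun a _ => e a, Finset.sum_sub_distrib, Finset.sum_ite_eq', Finset.sum_ite_eq',
    if_pos (Finset.mem_univ _), if_pos (Finset.mem_univ _)]
  ring

/-- The test vectors lie on the hyperplane: `h_x · λ = 0`. [folklore] -/
theorem test_vector_mem (lam : Fin 5 → ℂ) (z₀ x : Fin 5) :
    ∑ a : Fin 5, (lam z₀ * (if a = x then (1 : ℂ) else 0) - lam x * (if a = z₀ then (1 : ℂ) else 0)) * lam a = 0 := by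
  have e : ∀ a : Fin 5, (lam z₀ * (if a = x then (1 : ℂ) else 0) - lam x * (if a = z₀ then (1 : ℂ) else 0)) * lam a
      = (if a = x then lam z₀ * lam a else 0) - (if a = z₀ then lam x * lam a else 0) := by
    intro a
    split_ifs <;> ring
  rw [Finset.sum_congr rfl fun a _ => e a, Finset.sum_sub_distrib, Finset.sum_ite_eq', Finset.sum_ite_eq',
    if_pos (Finset.mem_univ _), if_pos (Finset.mem_univ _)]
  ring

/-- **Case (b), non-degenerate: `K ∈ L · ⟨L², Q''⟩`.**  Reduced minors `det[∂K | λ | ∂Q''] = 0`, `K` a cubic form, and two test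
derivatives `D_{h_{x₁}} Q''`, `D_{h_{x₂}} Q''` that are NOT proportional.  Then `K = C β · L · Q'' + C c · L³`. [folklore] -/
theorem cubic_of_square_member_nondeg (lam : Fin 5 → ℂ) (z₀ : Fin 5) (hlam : lam z₀ ≠ 0)
    (U'' : Fin 5 → Fin 5 → ℂ) (hU : ∀ a b : Fin 5, U'' a b = U'' b a)
    (Q'' K : MvPolynomial (Fin 5) ℂ) (hQ : Q'' = ∑ a : Fin 5, ∑ b : Fin 5, C (U'' a b) * X a * X b)
    (hK3 : K.IsHomogeneous 3)
    (hT' : ∀ a b c : Fin 5, pderiv a K * (C (lam b) * pderiv c Q'' - C (lam c) * pderiv b Q'')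
      - pderiv b K * (C (lam a) * pderiv c Q'' - C (lam c) * pderiv a Q'')
      + pderiv c K * (C (lam a) * pderiv b Q'' - C (lam b) * pderiv a Q'') = 0)
    (x₁ x₂ i j : Fin 5)
    (hν : (lam z₀ * U'' x₁ i - lam x₁ * U'' z₀ i) * (lam z₀ * U'' x₂ j - lam x₂ * U'' z₀ j)
      - (lam z₀ * U'' x₁ j - lam x₁ * U'' z₀ j) * (lam z₀ * U'' x₂ i - lam x₂ * U'' z₀ i) ≠ 0) :
    ∃ β c : ℂ, K = C β * (∑ z : Fin 5, lam z • (X z : MvPolynomial (Fin 5) ℂ)) * Q''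
      + C c * (∑ z : Fin 5, lam z • (X z : MvPolynomial (Fin 5) ℂ)) ^ 3 := by
  classical
  set L : MvPolynomial (Fin 5) ℂ := ∑ z : Fin 5, lam z • (X z : MvPolynomial (Fin 5) ℂ) with hL
  -- test vectors and the associated directional derivatives
  set h : Fin 5 → Fin 5 → ℂ := fun x a =>
    lam z₀ * (if a = x then (1 : ℂ) else 0) - lam x * (if a = z₀ then (1 : ℂ) else 0) with hh
  set ν : Fin 5 → Fin 5 → ℂ := fun x d => lam z₀ * U'' x d - lam x * U'' z₀ d with hνdef
  have hmem : ∀ x : Fin 5, ∑ a : Fin 5, h x a * lam a = 0 := fun x => test_vector_mem lam z₀ x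
  have hQx : ∀ x : Fin 5, ∑ a : Fin 5, C (h x a) * pderiv a Q'' = ∑ d : Fin 5, (2 * ν x d) • (X d : MvPolynomial (Fin 5) ℂ) :=
    fun x => by rw [hQ]; exact dirDeriv_quadric_test U'' hU lam z₀ x
  -- (α) wedge on the hyperplane
  have hwedge : ∀ v w : Fin 5 → ℂ, ∑ a : Fin 5, v a * lam a = 0 → ∑ a : Fin 5, w a * lam a = 0 →
      (∑ c : Fin 5, C (w c) * pderiv c K) * (∑ b : Fin 5, C (v b) * pderiv b Q'')
        = (∑ b : Fin 5, C (v b) * pderiv b K) * (∑ c : Fin 5, C (w c) * pderiv c Q'') :=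
    fun v w hv hw => wedge_on_hyperplane (fun a => pderiv a K) (fun a => pderiv a Q'') lam z₀ hlam hT' v w hv hw
  -- the two linear forms `L₁ = D_{h₁} Q''`, `L₂ = D_{h₂} Q''`
  set L₁ : MvPolynomial (Fin 5) ℂ := ∑ a : Fin 5, C (h x₁ a) * pderiv a Q'' with hL₁
  set L₂ : MvPolynomial (Fin 5) ℂ := ∑ a : Fin 5, C (h x₂ a) * pderiv a Q'' with hL₂
  have hL₁h : L₁.IsHomogeneous 1 := by
    rw [hL₁, hQx x₁]; exact Literature.RingTheory.MvPolynomial.isHomogeneous_one_sum_smul_X _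
  have hL₂h : L₂.IsHomogeneous 1 := by
    rw [hL₂, hQx x₂]; exact Literature.RingTheory.MvPolynomial.isHomogeneous_one_sum_smul_X _
  have hL₁0 : L₁ ≠ 0 := by
    intro h0
    rw [hL₁, hQx x₁, Literature.RingTheory.MvPolynomial.sum_smul_X_eq_zero_iff] at h0
    have hi : 2 * ν x₁ i = 0 := congr_fun h0 i
    have hj : 2 * ν x₁ j = 0 := congr_fun h0 j
    apply hν
    simp only [hνdef] at hi hj
    linear_combination (lam z₀ * U'' x₂ j - lam x₂ * U'' z₀ j) / 2 * hi - (lam z₀ * U'' x₂ i - lam x₂ * U'' z₀ i) / 2 * hj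
  have hL₁p : Prime L₁ := prime_of_totalDegree_eq_one (hL₁h.totalDegree hL₁0)
  have hL₁L₂ : ¬ L₁ ∣ L₂ := by
    intro hd
    obtain ⟨κ, hκ⟩ := eq_C_mul_of_dvd_linear hL₁h hL₁0 hL₂h hd
    rw [hL₁, hL₂, hQx x₁, hQx x₂] at hκ
    have hc : ∀ d : Fin 5, 2 * ν x₂ d = κ * (2 * ν x₁ d) := by
      intro d
      have h1 := congr_arg (coeff (Finsupp.single d 1)) hκ
      rw [Literature.RingTheory.MvPolynomial.coeff_single_one_sum_smul_X, coeff_C_mul,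
        Literature.RingTheory.MvPolynomial.coeff_single_one_sum_smul_X] at h1
      exact h1
    apply hν
    have hi := hc i
    have hj := hc j
    simp only [hνdef] at hi hj
    linear_combination (-(lam z₀ * U'' x₁ j - lam x₁ * U'' z₀ j)) / 2 * hi + (lam z₀ * U'' x₁ i - lam x₁ * U'' z₀ i) / 2 * hj
  -- `K₁ = B · L₁`
  have h12 := hwedge (h x₁) (h x₂) (hmem x₁) (hmem x₂)
  -- h12 : K₂ * L₁ = K₁ * L₂
  have hdvd : L₁ ∣ (∑ b : Fin 5, C (h x₁ b) * pderiv b K) * L₂ := ⟨∑ c : Fin 5, C (h x₂ c) * pderiv c K, by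
    rw [← h12]; ring⟩
  obtain ⟨B, hB⟩ : L₁ ∣ ∑ b : Fin 5, C (h x₁ b) * pderiv b K := (hL₁p.dvd_or_dvd hdvd).resolve_right hL₁L₂
  -- `K_v = B · Q_v` for every `v ∈ ker λ`
  have hKv : ∀ v : Fin 5 → ℂ, ∑ a : Fin 5, v a * lam a = 0 →
      ∑ a : Fin 5, C (v a) * pderiv a K = B * ∑ a : Fin 5, C (v a) * pderiv a Q'' := by
    intro v hv
    have h1 := hwedge v (h x₁) hv (hmem x₁)
    -- h1 : K₁ * Q_v = K_v * L₁
    rw [hB] at h1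
    apply mul_left_cancel₀ hL₁0
    linear_combination -h1
  -- `B` is a linear form
  have hK₁h : (∑ b : Fin 5, C (h x₁ b) * pderiv b K).IsHomogeneous 2 := by
    have h2 := dirDeriv_isHomogeneous (h x₁) hK3
    simpa using h2
  have hBh : B.IsHomogeneous 1 := by
    refine isHomogeneous_of_mul_eq (d := 1) (m := 1) (n := 2) hL₁h hL₁0 hK₁h ?_ rfl
    rw [hB]; ring
  set b : Fin 5 → ℂ := fun z => coeff (Finsupp.single z 1) B with hbdef
  have hBlin : B = ∑ z : Fin 5, b z • (X z : MvPolynomial (Fin 5) ℂ) :=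
    Literature.RingTheory.MvPolynomial.eq_sum_coeff_single_one_smul_X hBh
  -- Hessian symmetry: `C(b·w) Q_v = C(b·v) Q_w` on `ker λ`
  have hsymm : ∀ v w : Fin 5 → ℂ, ∑ a : Fin 5, v a * lam a = 0 → ∑ a : Fin 5, w a * lam a = 0 →
      C (∑ a : Fin 5, w a * b a) * (∑ a : Fin 5, C (v a) * pderiv a Q'')
        = C (∑ a : Fin 5, v a * b a) * (∑ a : Fin 5, C (w a) * pderiv a Q'') := by
    intro v w hv hw
    have e1 := congr_arg (fun F => ∑ c : Fin 5, C (w c) * pderiv c F) (hKv v hv)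
    have e2 := congr_arg (fun F => ∑ c : Fin 5, C (v c) * pderiv c F) (hKv w hw)
    rw [dirDeriv_mul, hBlin, dirDeriv_sum_smul_X, ← hBlin] at e1 e2
    rw [dirDeriv_comm w v K] at e1
    rw [e1, dirDeriv_comm v w Q''] at e2
    linear_combination e2
  -- hence `b ∥ λ`
  have hbh : ∀ x : Fin 5, ∑ a : Fin 5, h x a * b a = 0 := by
    intro x
    by_contra hx
    have e1 := hsymm (h x) (h x₁) (hmem x) (hmem x₁)
    have e2 := hsymm (h x) (h x₂) (hmem x) (hmem x₂)
    rw [hQx x, hQx x₁] at e1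
    rw [hQx x, hQx x₂] at e2
    have c1 : ∀ d : Fin 5, (∑ a : Fin 5, h x₁ a * b a) * (2 * ν x d) = (∑ a : Fin 5, h x a * b a) * (2 * ν x₁ d) := by
      intro d
      have h1 := congr_arg (coeff (Finsupp.single d 1)) e1
      rwa [coeff_C_mul, coeff_C_mul, Literature.RingTheory.MvPolynomial.coeff_single_one_sum_smul_X,
        Literature.RingTheory.MvPolynomial.coeff_single_one_sum_smul_X] at h1
    have c2 : ∀ d : Fin 5, (∑ a : Fin 5, h x₂ a * b a) * (2 * ν x d) = (∑ a : Fin 5, h x a * b a) * (2 * ν x₂ d) := by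
      intro d
      have h1 := congr_arg (coeff (Finsupp.single d 1)) e2
      rwa [coeff_C_mul, coeff_C_mul, Literature.RingTheory.MvPolynomial.coeff_single_one_sum_smul_X,
        Literature.RingTheory.MvPolynomial.coeff_single_one_sum_smul_X] at h1
    set βx := ∑ a : Fin 5, h x a * b a with hβx
    set β₁ := ∑ a : Fin 5, h x₁ a * b a with hβ₁
    set β₂ := ∑ a : Fin 5, h x₂ a * b a with hβ₂
    have hsq : βx ^ 2 * ((lam z₀ * U'' x₁ i - lam x₁ * U'' z₀ i) * (lam z₀ * U'' x₂ j - lam x₂ * U'' z₀ j)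
        - (lam z₀ * U'' x₁ j - lam x₁ * U'' z₀ j) * (lam z₀ * U'' x₂ i - lam x₂ * U'' z₀ i)) = 0 := by
      have ci := c1 i
      have cj := c1 j
      have di := c2 i
      have dj := c2 j
      simp only [hνdef] at ci cj di dj
      linear_combination (-(βx * (lam z₀ * U'' x₂ j - lam x₂ * U'' z₀ j))) / 2 * ci
        + (βx * (lam z₀ * U'' x₂ i - lam x₂ * U'' z₀ i)) / 2 * cj
        - (β₁ * (lam z₀ * U'' x i - lam x * U'' z₀ i)) / 2 * dj
        + (β₁ * (lam z₀ * U'' x j - lam x * U'' z₀ j)) / 2 * di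
    rcases mul_eq_zero.mp hsq with h0 | h0
    · exact hx (pow_eq_zero_iff (two_ne_zero) |>.mp h0)
    · exact hν h0
  -- `B = C β * L`
  have hbz : ∀ z : Fin 5, b z = b z₀ / lam z₀ * lam z := by
    intro z
    have e := hbh z
    have e2 : ∑ a : Fin 5, h z a * b a = lam z₀ * b z - lam z * b z₀ := by
      simp only [hh]
      have e3 : ∀ a : Fin 5, (lam z₀ * (if a = z then (1 : ℂ) else 0) - lam z * (if a = z₀ then (1 : ℂ) else 0)) * b a
          = (if a = z then lam z₀ * b a else 0) - (if a = z₀ then lam z * b a else 0) := by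
        intro a
        split_ifs <;> ring
      rw [Finset.sum_congr rfl fun a _ => e3 a, Finset.sum_sub_distrib, Finset.sum_ite_eq', Finset.sum_ite_eq',
        if_pos (Finset.mem_univ _), if_pos (Finset.mem_univ _)]
    rw [e2] at e
    rw [div_mul_eq_mul_div, eq_div_iff hlam]
    linear_combination e
  have hBL : B = C (b z₀ / lam z₀) * L := by
    rw [hBlin, hL, Finset.mul_sum]
    exact Finset.sum_congr rfl fun z _ => by rw [hbz z, smul_eq_C_mul, smul_eq_C_mul, map_mul, mul_assoc]
  -- `F := K − C β L Q''` is killed by every `D_v`, `v ∈ ker λ`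
  set β : ℂ := b z₀ / lam z₀ with hβ
  have hF : ∀ v : Fin 5 → ℂ, ∑ a : Fin 5, v a * lam a = 0 →
      ∑ a : Fin 5, C (v a) * pderiv a (K - C β * L * Q'') = 0 := by
    intro v hv
    have e : ∑ a : Fin 5, C (v a) * pderiv a (K - C β * L * Q'')
        = (∑ a : Fin 5, C (v a) * pderiv a K) - ∑ a : Fin 5, C (v a) * pderiv a (C β * L * Q'') := by
      rw [← Finset.sum_sub_distrib]
      exact Finset.sum_congr rfl fun a _ => by rw [map_sub, mul_sub]
    rw [e, dirDeriv_mul, dirDeriv_mul, dirDeriv_C, hL, dirDeriv_sum_smul_X, ← hL, hv, C_0, hKv v hv, hBL]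
    ring
  have hFh : (K - C β * L * Q'').IsHomogeneous 3 := by
    refine hK3.sub ?_
    have h1 : (C β * L * Q'').IsHomogeneous (0 + 1 + 2) :=
      ((isHomogeneous_C _ _).mul (Literature.RingTheory.MvPolynomial.isHomogeneous_one_sum_smul_X lam)).mul
        (by rw [hQ]; exact quadric_isHomogeneous U'')
    simpa using h1
  obtain ⟨c, hc⟩ := eq_C_mul_pow_of_dirDeriv_eq_zero lam z₀ hlam 3 _ hFh hF
  exact ⟨β, c, by rw [← hc]; ring⟩

/-- The test form `T_M(a,b) = M(h_a, h_b)` of a symmetric matrix in terms of `ν_b(a) = λ_{z₀} M(b,a) − λ_b M(z₀,a)`: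
`T_M(a,b) = λ_{z₀} ν_b(a) − λ_a ν_b(z₀)`. [folklore] -/
theorem test_form_eq (M : Fin 5 → Fin 5 → ℂ) (hM : ∀ a b : Fin 5, M a b = M b a) (lam : Fin 5 → ℂ) (z₀ a b : Fin 5) :
    lam z₀ * (lam z₀ * M a b - lam b * M a z₀) - lam a * (lam z₀ * M z₀ b - lam b * M z₀ z₀)
      = lam z₀ * (lam z₀ * M b a - lam b * M z₀ a) - lam a * (lam z₀ * M b z₀ - lam b * M z₀ z₀) := by
  rw [hM a b, hM a z₀, hM b z₀]

/-- **Case (b), degenerate: the pencil is binary.**  If all the vectors `ν_x = (λ_{z₀} U''(x,·) − λ_x U''(z₀,·))` (`= U'' h_x`,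
`h_x = λ_{z₀} e_x − λ_x e_{z₀}` spanning `ker λ`) are pairwise parallel, then every column of `U''` lies in the plane `⟨λ, f⟩` for a
single vector `f`. [folklore] -/
theorem binary_of_square_member_deg (lam : Fin 5 → ℂ) (z₀ : Fin 5) (hlam : lam z₀ ≠ 0)
    (U'' : Fin 5 → Fin 5 → ℂ) (hU : ∀ a b : Fin 5, U'' a b = U'' b a)
    (hpar : ∀ x₁ x₂ i j : Fin 5,
      (lam z₀ * U'' x₁ i - lam x₁ * U'' z₀ i) * (lam z₀ * U'' x₂ j - lam x₂ * U'' z₀ j)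
        = (lam z₀ * U'' x₁ j - lam x₁ * U'' z₀ j) * (lam z₀ * U'' x₂ i - lam x₂ * U'' z₀ i)) :
    ∃ f : Fin 5 → ℂ, ∀ d : Fin 5, ∃ s t : ℂ, ∀ x : Fin 5, U'' x d = s * lam x + t * f x := by
  classical
  by_cases hall : ∀ x d : Fin 5, lam z₀ * U'' x d - lam x * U'' z₀ d = 0
  · refine ⟨lam, fun d => ⟨U'' z₀ d / lam z₀, 0, fun x => ?_⟩⟩
    rw [zero_mul, add_zero, div_mul_eq_mul_div, eq_div_iff hlam]
    linear_combination hall x d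
  simp only [not_forall] at hall
  obtain ⟨x₁, i₁, hx₁⟩ := hall
  -- `μ := ν_{x₁} ≠ 0`; every `ν_x` is `φ_x · μ`
  set μ : Fin 5 → ℂ := fun d => lam z₀ * U'' x₁ d - lam x₁ * U'' z₀ d with hμ
  have hμ0 : μ i₁ ≠ 0 := hx₁
  set φ : Fin 5 → ℂ := fun x => (lam z₀ * U'' x i₁ - lam x * U'' z₀ i₁) / μ i₁ with hφ
  have hν : ∀ x d : Fin 5, lam z₀ * U'' x d - lam x * U'' z₀ d = φ x * μ d := by
    intro x d
    have h := hpar x x₁ d i₁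
    simp only [hφ, hμ]
    rw [div_mul_eq_mul_div, eq_div_iff hμ0]
    linear_combination h
  -- `ψ_a = h_a · μ`; the test form of `U''` is `φ_b ψ_a`, and it is symmetric
  set ψ : Fin 5 → ℂ := fun a => lam z₀ * μ a - lam a * μ z₀ with hψ
  have hT : ∀ a b : Fin 5,
      lam z₀ * (lam z₀ * U'' a b - lam b * U'' a z₀) - lam a * (lam z₀ * U'' z₀ b - lam b * U'' z₀ z₀) = φ b * ψ a := by
    intro a b
    rw [test_form_eq U'' hU lam z₀ a b, hν b a, hν b z₀, hψ]
    ring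
  have hφψ : ∀ a b : Fin 5, φ b * ψ a = φ a * ψ b := by
    intro a b
    rw [← hT a b, ← hT b a, test_form_eq U'' hU lam z₀ a b]
    rw [hU b a, hU b z₀, hU z₀ a]
    ring
  by_cases hψ0 : ∀ a : Fin 5, ψ a = 0
  · -- `U''` vanishes on `H × H`
    obtain ⟨m, hm⟩ := eq_symm_rankTwo_of_vanishing U'' hU lam z₀ hlam (fun a b => by rw [hT a b, hψ0 a, mul_zero])
    exact ⟨m, fun d => ⟨m d, lam d, fun x => by rw [hm x d]; ring⟩⟩
  · simp only [not_forall] at hψ0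
    obtain ⟨a₂, ha₂⟩ := hψ0
    set κ : ℂ := φ a₂ / ψ a₂ with hκ
    have hφκ : ∀ b : Fin 5, φ b = κ * ψ b := by
      intro b
      rw [hκ, div_mul_eq_mul_div, eq_div_iff ha₂]
      exact hφψ a₂ b
    -- `U'' − κ μμᵀ` vanishes on `H × H`
    have hMs : ∀ a b : Fin 5, U'' a b - κ * (μ a * μ b) = U'' b a - κ * (μ b * μ a) := fun a b => by
      rw [hU a b]; ring
    obtain ⟨m, hm⟩ := eq_symm_rankTwo_of_vanishing (fun a b => U'' a b - κ * (μ a * μ b)) hMs lam z₀ hlam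
      (fun a b => by
        have h := hT a b
        rw [hφκ b] at h
        simp only [hψ] at h ⊢
        linear_combination h)
    -- `m ∥ λ`
    have hmz : ∀ a : Fin 5, m a = m z₀ / lam z₀ * lam a := by
      intro a
      have h1 := hν a z₀
      have e1 : U'' a z₀ = κ * (μ a * μ z₀) + (lam a * m z₀ + m a * lam z₀) := by
        have := hm a z₀; linear_combination this
      have e2 : U'' z₀ z₀ = κ * (μ z₀ * μ z₀) + (lam z₀ * m z₀ + m z₀ * lam z₀) := by
        have := hm z₀ z₀; linear_combination this
      rw [e1, e2, hφκ a] at h1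
      simp only [hψ] at h1
      rw [div_mul_eq_mul_div, eq_div_iff hlam]
      have h2 : lam z₀ * (lam z₀ * m a - lam a * m z₀) = 0 := by linear_combination h1
      have h3 := (mul_eq_zero.mp h2).resolve_left hlam
      linear_combination h3
    refine ⟨μ, fun d => ⟨2 * m z₀ / lam z₀ * lam d, κ * μ d, fun x => ?_⟩⟩
    have h := hm x d
    rw [hmz x, hmz d] at h
    linear_combination h

end LaplaceFiveStar

end Summit.ValiantsHypothesis.ValiantsHypothesis.Theorems.RigidityForcesSymmetryRankRigidMinimalRepr
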